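import Summits.AtomisticToContinuum.HydrodynamicLimit.Theorems.StiffCollisionalRelaxationAprioriBoundsFibreDeficitMeanBound
import Summits.AtomisticToContinuum.HydrodynamicLimit.Theorems.StiffCollisionalRelaxationAprioriBoundsFibreDeficitHoeffding
import Literature.Probability.Entropy.EntropyInequality
import HarnessLib

/-!
# The lever `stub_deficitTransfer` of the line `fibre-deficit-transfer` (crux `AprioriBounds`,
stmt-AtomisticToContinuum-14827), part 4: the entropy-inequality transfer (registered stub `stub_deficitTransfer`)

Proof file (`--supports stmt-AtomisticToContinuum-14827`) of the lead prover of the line.  THE LEVER of the line: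
`LinearHydroRateAt ∧ TiltedExcessAt ∧ EnergyMomentAt ⟹ BulkTailAt` — sub-Maxwellian one-particle velocity tails at
every level, at each fixed time `s ≤ t`, with polynomial slack and polynomial probability, for the law `μ_s` of the
hard-sphere gas started from local Gibbs data, given ONE rated linear statistic, statics, and an energy moment.

Assembly of parts 1–3: `H(μ_s | G_s) ≤ C₁(N+1)^{1−a₁}` (part 2, `klDiv_lawAt_slice_le_pow`, with `G_s` the local Gibbs law
of the slice profile, part 1), `G_s{2Ae^{−K/(2Θ)} + δ < frac_K} ≤ e^{−2(N+1)δ²}` uniformly in `K` (part 3,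
`exists_frac_tail_bound`, the temperatures and drifts of the classical solution being bounded on the compact slab), and
the entropy inequality for events (Kipnis–Landim 1999 A1.8.2, `Literature.Probability.Entropy.KipnisLandim1999_A1_8_2_holds`)
with `δ = (N+1)^{−a₁/3}`:  `μ_s{…} ≤ (log 2 + C₁(N+1)^{1−a₁}) / (2(N+1)^{1−2a₁/3}) = O((N+1)^{−a₁/3}) ≤ (N+1)^{−a₁/4}`.
-/

noncomputable section

open MeasureTheory Filter Set Topology InformationTheory
open scoped ENNReal

namespace Summit.AtomisticToContinuum.HydrodynamicLimit.Theorems.FibreDeficitTransfer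

open Literature.MathematicalPhysics.KineticTheory Literature.Analysis.FluidPDE
open Summit.AtomisticToContinuum.HydrodynamicLimit.Theorems.AprioriBoundsNegative (PartOneAt PartTwoAt)
open Summit.AtomisticToContinuum.HydrodynamicLimit.Theorems.VisitLedgerUpscattering (Cfg Flow Flows NiceProfiles)
open MacroClosureLine.StubLedger JaynesSqueezeClosure

/-- **The entropy inequality, solved for the event.**  For probability measures `μ ≪ π` with `H(μ | π) ≤ H₀ < ∞` and
an event `A` with `π A ≤ e^{−L}`, `L > 0`:  `μ A ≤ (log 2 + H₀)/L` (Kipnis–Landim A1.8.2; the case `π A = 0` by absolute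
continuity). -/
theorem measure_le_of_klDiv_le {Ω : Type} [MeasurableSpace Ω] (μ π : Measure Ω) [IsProbabilityMeasure μ]
    [IsProbabilityMeasure π] (hac : μ ≪ π) (hkl : klDiv μ π ≠ ⊤) {H₀ L : ℝ} (hH : (klDiv μ π).toReal ≤ H₀) (hL : 0 < L)
    {A : Set Ω} (hA : MeasurableSet A) (hπA : π A ≤ ENNReal.ofReal (Real.exp (-L))) :
    (μ A).toReal ≤ (Real.log 2 + H₀) / L := by
  have hH0 : 0 ≤ H₀ := ENNReal.toReal_nonneg.trans hH
  by_cases h0 : π A = 0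
  · rw [hac h0, ENNReal.toReal_zero]
    positivity
  have hq : 0 < (π A).toReal := ENNReal.toReal_pos h0 (measure_ne_top _ _)
  have hqle : (π A).toReal ≤ Real.exp (-L) := ENNReal.toReal_le_of_le_ofReal (Real.exp_pos _).le hπA
  have hKL := Literature.Probability.Entropy.KipnisLandim1999_A1_8_2_holds Ω μ π A hA h0 hkl
  -- `log (1 + 1/π A) ≥ L`
  have hlog : L ≤ Real.log (1 + (π A).toReal⁻¹) := by
    have h1 : Real.exp L ≤ (π A).toReal⁻¹ := by
      have h := inv_anti₀ hq hqle
      rwa [Real.exp_neg, inv_inv] at h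
    calc L = Real.log (Real.exp L) := (Real.log_exp L).symm
      _ ≤ Real.log (1 + (π A).toReal⁻¹) := Real.log_le_log (Real.exp_pos L) (by linarith)
  calc (μ A).toReal ≤ (Real.log 2 + (klDiv μ π).toReal) / Real.log (1 + (π A).toReal⁻¹) := hKL
    _ ≤ (Real.log 2 + H₀) / Real.log (1 + (π A).toReal⁻¹) := by
        gcongr
        exact (hL.trans_le hlog).le
    _ ≤ (Real.log 2 + H₀) / L := div_le_div_of_nonneg_left (by positivity) hL hlog

/-- **Relative-entropy hydrodynamics gives the bulk tails.**  For `0 < σ < 1/2`, nice profiles, a flow family, `t > 0`,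
slice fields `u, θ > 0` jointly continuous on `[0,t] × 𝕋³` and a jointly continuous density multiplier `λ₀` along `(ρ, u, θ)`:
if the relative entropy of the law at time `s` against local Gibbs laws `G_s = localGibbsLaw σ (b s) (u s) (θ s)` with ANY
continuous positive activities `b s` is SUB-EXTENSIVE with a rate, `H(μ_s | G_s) ≤ C₁(N+1)^{1−a₁}` for all `N ≥ N₀`, `s ≤ t`
(uniformly), then `BulkTailAt` holds (Hoeffding under `G_s` + the entropy inequality).  This is the form in which ANY producer of
Yau-type relative-entropy closeness at fixed times — e.g. a uniform-in-`s` version of `KnudsenRateHorizon.EntropyKnudsenRate`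
(stmt-12339, `klDiv ≤ C(N+1)^{2/3}` against `localGibbsLaw σ a (u t) (θ t)`), not only the line's `LinearHydroRateAt ∧ TiltedExcessAt`
— feeds component (i) of the crux. -/
theorem bulkTailAt_of_klDiv_le_pow {σ : ℝ} {a₀ θ₀ : T3 → ℝ} {u₀ : T3 → V3} {b θ : ℝ → T3 → ℝ} {u : ℝ → T3 → V3}
    {Φ : (N : ℕ) → HardSphereFlow (Torus.geometry (Fin 3)) (hsDiameter σ N) (N + 1)} {t : ℝ}
    (hσ2 : σ < 1 / 2) (hP : NiceProfiles a₀ θ₀ u₀)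
    (hθc : ContinuousOn (Function.uncurry θ) (Icc 0 t ×ˢ univ)) (huc : ContinuousOn (Function.uncurry u) (Icc 0 t ×ˢ univ))
    (hθ : ∀ s ∈ Icc 0 t, ∀ x, 0 < θ s x) (hbc : ∀ s ∈ Icc 0 t, Continuous (b s)) (hbpos : ∀ s ∈ Icc 0 t, ∀ x, 0 < b s x)
    {a₁ C₁ : ℝ} (ha₁ : 0 < a₁) {N₀ : ℕ}
    (hH : ∀ N : ℕ, N₀ ≤ N → ∀ s ∈ Icc 0 t, (klDiv ((Φ N).lawAt (localGibbsLaw σ a₀ u₀ θ₀ N (Φ N)) s)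
      (localGibbsLaw σ (b s) (u s) (θ s) N (Φ N))).toReal ≤ C₁ * ((N : ℝ) + 1) ^ (1 - a₁)) :
    BulkTailAt σ a₀ θ₀ u₀ Φ t := by
  have hσ2' : σ ≤ 1 / 2 := hσ2.le
  obtain ⟨ha, hθ₀, hu₀, ha0, hθ0⟩ := hP
  -- uniform bounds of the slice temperatures and drifts
  obtain ⟨Θm', -, hΘm'⟩ := exists_bound_slab (f := fun p : ℝ × T3 => θ p.1 p.2) hθc
  obtain ⟨U, -, hU⟩ := exists_bound_slab (f := fun p : ℝ × T3 => ‖u p.1 p.2‖) huc.norm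
  set Θm : ℝ := max Θm' 1 with hΘm
  have hΘmpos : 0 < Θm := lt_of_lt_of_le one_pos (le_max_right _ _)
  have hθle : ∀ s ∈ Icc 0 t, ∀ x, θ s x ≤ Θm := fun s hs x =>
    ((le_abs_self _).trans (hΘm' s hs x)).trans (le_max_left _ _)
  have hule : ∀ s ∈ Icc 0 t, ∀ x, ‖u s x‖ ≤ U := fun s hs x => (le_abs_self _).trans (hU s hs x)
  -- part 3: Hoeffding constants
  obtain ⟨Θ, A, hΘ, hA, htail⟩ := exists_frac_tail_bound Θm U hΘmpos
  -- exponents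
  set a' : ℝ := min a₁ 1 with ha'
  have ha'pos : 0 < a' := lt_min ha₁ one_pos
  have ha'le : a' ≤ 1 := min_le_right _ _
  have ha'le₁ : a' ≤ a₁ := min_le_left _ _
  set a : ℝ := a' / 4 with ha_def
  have hapos : 0 < a := by positivity
  -- the constant of the transferred bound and the threshold
  set M : ℝ := (Real.log 2 + |C₁|) / 2 with hM
  have hM0 : 0 < M := by have := Real.log_pos (by norm_num : (1 : ℝ) < 2); positivity
  obtain ⟨N₁, hN₁⟩ := exists_nat_ge (M ^ (12 / a'))
  refine ⟨Θ, A, a, hΘ, hapos, max N₀ N₁, fun N hN s hs K => ?_⟩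
  have hNN₀ : N₀ ≤ N := (le_max_left _ _).trans hN
  have hNN₁ : N₁ ≤ N := (le_max_right _ _).trans hN
  have hE : (1 : ℝ) ≤ (N : ℝ) + 1 := by linarith [(Nat.cast_nonneg N : (0 : ℝ) ≤ N)]
  have hEpos : (0 : ℝ) < (N : ℝ) + 1 := by positivity
  -- the reference at time `s`, its basic properties
  have hθs : Continuous (θ s) := continuous_slice hθc hs
  have hus : Continuous (u s) := continuous_slice huc hs
  have hθpos : ∀ x, 0 < θ s x := hθ s hs
  have hbs : Continuous (b s) := hbc s hs
  have hbspos : ∀ x, 0 < b s x := hbpos s hs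
  set μ₀ := localGibbsLaw σ a₀ u₀ θ₀ N (Φ N) with hμ₀
  set G := localGibbsLaw σ (b s) (u s) (θ s) N (Φ N) with hG
  haveI hμ₀P : IsProbabilityMeasure μ₀ := isProbabilityMeasure_localGibbsLaw ha hθ₀ hu₀ ha0 hθ0 hσ2' N (Φ N)
  haveI hGP : IsProbabilityMeasure G := isProbabilityMeasure_localGibbsLaw hbs hθs hus hbspos hθpos hσ2' N (Φ N)
  set μs := (Φ N).lawAt μ₀ s with hμs
  haveI hμsP : IsProbabilityMeasure μs := by
    rw [hμs, HardSphereFlow.lawAt_eq]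
    exact Measure.isProbabilityMeasure_map ((Φ N).measurable_flow s).aemeasurable
  have hkl : klDiv μs G ≠ ⊤ :=
    klDiv_lawAt_localGibbsLaw_ne_top hσ2' ha hθ₀ hu₀ ha0 hθ0 hbs hθs hus hbspos hθpos N (Φ N) s
  have hac : μs ≪ G := (klDiv_ne_top_iff.1 hkl).1
  -- the relative-entropy budget
  have hHs : (klDiv μs G).toReal ≤ |C₁| * ((N : ℝ) + 1) ^ (1 - a') := by
    refine (hH N hNN₀ s hs).trans ?_
    calc C₁ * ((N : ℝ) + 1) ^ (1 - a₁) ≤ |C₁| * ((N : ℝ) + 1) ^ (1 - a₁) :=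
          mul_le_mul_of_nonneg_right (le_abs_self _) (Real.rpow_nonneg hEpos.le _)
      _ ≤ |C₁| * ((N : ℝ) + 1) ^ (1 - a') :=
          mul_le_mul_of_nonneg_left (Real.rpow_le_rpow_of_exponent_le hE (by linarith)) (abs_nonneg _)
  -- the Hoeffding bound for the reference at `δ = (N+1)^{-a'/3}`
  set δ : ℝ := ((N : ℝ) + 1) ^ (-(a' / 3)) with hδ
  have hδ0 : 0 ≤ δ := Real.rpow_nonneg hEpos.le _
  set Aev : Set (Cfg N) := {w | 2 * A * Real.exp (-(K / (2 * Θ))) + δ < frac K w} with hAev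
  have hAevm : MeasurableSet Aev := measurableSet_lt measurable_const (measurable_frac K)
  have hGA : G Aev ≤ ENNReal.ofReal (Real.exp (-(2 * ((N : ℝ) + 1) * δ ^ 2))) :=
    htail σ (b s) (θ s) (u s) hσ2' hbs hθs hus hbspos hθpos (hθle s hs) (hule s hs) N (Φ N) K δ hδ0
  set L : ℝ := 2 * ((N : ℝ) + 1) ^ (1 - 2 * a' / 3) with hL
  have hLpos : 0 < L := by positivity
  have hLeq : 2 * ((N : ℝ) + 1) * δ ^ 2 = L := by
    rw [hL, hδ, ← Real.rpow_natCast _ 2, ← Real.rpow_mul hEpos.le, mul_assoc, ← Real.rpow_one_add' hEpos.le]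
    · congr 1; push_cast; ring
    · push_cast; linarith
  rw [hLeq] at hGA
  -- transfer
  have hμsA : (μs Aev).toReal ≤ (Real.log 2 + |C₁| * ((N : ℝ) + 1) ^ (1 - a')) / L :=
    measure_le_of_klDiv_le μs G hac hkl hHs hLpos hAevm hGA
  -- arithmetic: the right-hand side is `≤ M (N+1)^{-a'/3} ≤ (N+1)^{-a}`
  have hpow1 : (1 : ℝ) ≤ ((N : ℝ) + 1) ^ (1 - a') := Real.one_le_rpow hE (by linarith)
  have harith : (Real.log 2 + |C₁| * ((N : ℝ) + 1) ^ (1 - a')) / L ≤ M * ((N : ℝ) + 1) ^ (-(a' / 3)) := by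
    have hlog2 : 0 < Real.log 2 := Real.log_pos (by norm_num)
    have hnum : Real.log 2 + |C₁| * ((N : ℝ) + 1) ^ (1 - a') ≤ (Real.log 2 + |C₁|) * ((N : ℝ) + 1) ^ (1 - a') := by
      nlinarith [abs_nonneg C₁]
    have hsplit : (Real.log 2 + |C₁|) * ((N : ℝ) + 1) ^ (1 - a') / L = M * ((N : ℝ) + 1) ^ (-(a' / 3)) := by
      rw [hL, hM]
      have h1 : ((N : ℝ) + 1) ^ (1 - a') = ((N : ℝ) + 1) ^ (1 - 2 * a' / 3) * ((N : ℝ) + 1) ^ (-(a' / 3)) := by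
        rw [← Real.rpow_add hEpos]; congr 1; ring
      rw [h1]
      have h2 : 0 < ((N : ℝ) + 1) ^ (1 - 2 * a' / 3) := Real.rpow_pos_of_pos hEpos _
      field_simp
    calc (Real.log 2 + |C₁| * ((N : ℝ) + 1) ^ (1 - a')) / L
        ≤ (Real.log 2 + |C₁|) * ((N : ℝ) + 1) ^ (1 - a') / L := div_le_div_of_nonneg_right hnum hLpos.le
      _ = M * ((N : ℝ) + 1) ^ (-(a' / 3)) := hsplit
  have hthr : M ≤ ((N : ℝ) + 1) ^ (a' / 12) := by
    have h1 : M ^ (12 / a') ≤ (N : ℝ) + 1 := hN₁.trans (by exact_mod_cast Nat.le_succ_of_le hNN₁)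
    have h2 : M = (M ^ (12 / a')) ^ (a' / 12) := by
      rw [← Real.rpow_mul hM0.le]
      have : 12 / a' * (a' / 12) = 1 := by field_simp
      rw [this, Real.rpow_one]
    rw [h2]
    exact Real.rpow_le_rpow (Real.rpow_nonneg hM0.le _) h1 (by positivity)
  have harith2 : M * ((N : ℝ) + 1) ^ (-(a' / 3)) ≤ ((N : ℝ) + 1) ^ (-a) := by
    calc M * ((N : ℝ) + 1) ^ (-(a' / 3)) ≤ ((N : ℝ) + 1) ^ (a' / 12) * ((N : ℝ) + 1) ^ (-(a' / 3)) :=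
          mul_le_mul_of_nonneg_right hthr (Real.rpow_nonneg hEpos.le _)
      _ = ((N : ℝ) + 1) ^ (-a) := by rw [← Real.rpow_add hEpos, ha_def]; congr 1; ring
  -- the crux's event is the pull-back of a SMALLER event (`δ ≤ (N+1)^{-a}`)
  have hδa : δ ≤ ((N : ℝ) + 1) ^ (-a) := by
    rw [hδ, ha_def]
    exact Real.rpow_le_rpow_of_exponent_le hE (by linarith)
  have hsub : {z : Cfg N | 2 * A * Real.exp (-(K / (2 * Θ))) + ((N : ℝ) + 1) ^ (-a) < frac K ((Φ N).flow s z)} ⊆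
      (Φ N).flow s ⁻¹' Aev := fun z hz => by
    simp only [mem_setOf_eq, mem_preimage, hAev] at hz ⊢
    linarith
  have hmap : μ₀ ((Φ N).flow s ⁻¹' Aev) = μs Aev := by
    rw [hμs, HardSphereFlow.lawAt_eq, Measure.map_apply ((Φ N).measurable_flow s) hAevm]
  calc μ₀ {z : Cfg N | 2 * A * Real.exp (-(K / (2 * Θ))) + ((N : ℝ) + 1) ^ (-a) < frac K ((Φ N).flow s z)}
      ≤ μ₀ ((Φ N).flow s ⁻¹' Aev) := measure_mono hsub
    _ = μs Aev := hmap
    _ ≤ ENNReal.ofReal (((N : ℝ) + 1) ^ (-a)) := by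
        rw [← ENNReal.ofReal_toReal (measure_ne_top μs Aev)]
        exact ENNReal.ofReal_le_ofReal ((hμsA.trans harith).trans harith2)

/-- STUB 6 of the line `fibre-deficit-transfer` — **THE LEVER** `stub_deficitTransfer` (registered signature): for
`0 < σ < 1/2`, nice profiles, `t > 0`, fields `(ρ, u, θ)` jointly continuous on `[0,t] × 𝕋³` with `θ > 0` and a jointly
continuous density multiplier along them, `LinearHydroRateAt ∧ TiltedExcessAt ∧ EnergyMomentAt ⟹ BulkTailAt`. -/
theorem stub_deficitTransfer : ∀ (σ : ℝ) (a₀ θ₀ : T3 → ℝ) (u₀ : T3 → V3) (ρ θ : ℝ → T3 → ℝ) (u : ℝ → T3 → V3) (Φ : (N : ℕ) → HardSphereFlow (Torus.geometry (Fin 3)) (hsDiameter σ N) (N + 1)) (t : ℝ), 0 < σ → σ < 1 / 2 → NiceProfiles a₀ θ₀ u₀ → 0 < t → ContinuousOn (Function.uncurry ρ) (Icc 0 t ×ˢ univ) → ContinuousOn (Function.uncurry θ) (Icc 0 t ×ˢ univ) → ContinuousOn (Function.uncurry u) (Icc 0 t ×ˢ univ) → (∀ s ∈ Icc 0 t, ∀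 x, 0 < θ s x) → ContinuousOn (fun p : ℝ × T3 => lam0 σ (ρ p.1 p.2) (θ p.1 p.2) (u p.1 p.2)) (Icc 0 t ×ˢ univ) → LinearHydroRateAt σ a₀ θ₀ u₀ ρ θ u Φ t → TiltedExcessAt σ a₀ θ₀ u₀ ρ θ u t → EnergyMomentAt σ a₀ θ₀ u₀ Φ → BulkTailAt σ a₀ θ₀ u₀ Φ t := by
  intro σ a₀ θ₀ u₀ ρ θ u Φ t hσ hσ2 hP ht hρc hθc huc hθ hΛ hRate hExc hMom
  -- part 2: sub-extensive relative entropy against the slice reference; then the transfer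
  obtain ⟨a₁, C₁, ha₁, N₀, hH⟩ := klDiv_lawAt_slice_le_pow σ a₀ θ₀ u₀ ρ θ u Φ t hσ hσ2 hP ht hρc hθc huc hθ hΛ hRate hExc hMom
  have hbc : ∀ s ∈ Icc 0 t, Continuous fun x => Real.exp (lam0 σ (ρ s x) (θ s x) (u s x) + ‖u s x‖ ^ 2 / (2 * θ s x)) *
      (2 * Real.pi * θ s x) ^ ((3 : ℝ) / 2) := fun s hs =>
    continuous_sliceAct s (continuous_slice hθc hs) (continuous_slice huc hs) (hθ s hs)
      (continuous_slice (f := fun s x => lam0 σ (ρ s x) (θ s x) (u s x)) hΛ hs)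
  have hbpos : ∀ s ∈ Icc 0 t, ∀ x, 0 < Real.exp (lam0 σ (ρ s x) (θ s x) (u s x) + ‖u s x‖ ^ 2 / (2 * θ s x)) *
      (2 * Real.pi * θ s x) ^ ((3 : ℝ) / 2) := fun s hs x => sliceAct_pos s x (hθ s hs x)
  exact bulkTailAt_of_klDiv_le_pow (b := fun s x => Real.exp (lam0 σ (ρ s x) (θ s x) (u s x) + ‖u s x‖ ^ 2 / (2 * θ s x)) *
    (2 * Real.pi * θ s x) ^ ((3 : ℝ) / 2)) hσ2 hP hθc huc hθ hbc hbpos ha₁ hH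

end Summit.AtomisticToContinuum.HydrodynamicLimit.Theorems.FibreDeficitTransfer

end
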